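import Literature.MathematicalPhysics.QuantumFieldTheory.Balaban1983to89.B8Ineq132
import Summits.QuantumFields.BalabanUV.T4Continuum.Support.BlockAverageLoopLogCore
import HarnessLib

/-!
# Gauge side of the curvature-gradient bound, file 1/3: the LATTICE BIANCHI IDENTITY (the boundary of a unit cube is a product of six
# lassoed plaquettes) and its normed form — the flat coboundary of the plaquette field of a near-identity configuration is
# `O(a² + βa)` (`a` = plaquette deviation, `β` = deviation of the three tail bonds)

Helper file (`--supports stmt-QuantumFields-19200`, crux child «MinimiserStabilityRegPr» of rung R3's K1, cell `ym3-torus`, seat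
`ym3-torus-p1` gen 13; memo HOME/UV3-NODE.md §22).  Theorems only; no new definition.  Objects: the `ℤ^d` model configurations
`V : Site d → Fin d → G` of the tree's `B7Prop1Explicit` (`hol`, `plaqWord`, `gaugeAct`, `U1`) and the plaquette field `plaqF` of `B8Ineq132`.

* §1 `norm_prod_sub_one_sub_sum_le` — `‖Π uₙ − 1 − Σ(uₙ − 1)‖ ≤ (1+a)^n − 1 − n·a` for `‖uₙ − 1‖ ≤ a` in a normed ring; conjugation
  (tree `BlockAverageLoopLogCore.norm_units_conj_sub_self_le`) and inversion move `X − 1` by `≤ 2‖u − 1‖‖X − 1‖`, `≤ ‖X − 1‖²`;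
* §2 **`bianchi_prod_eq_one`** — in ANY group: `[Vₓᵢ P(x+eᵢ;j,k) Vₓᵢ⁻¹]·P(x;i,k)·[Vₓₖ P(x+eₖ;i,j) Vₓₖ⁻¹]·P(x;j,k)⁻¹·[Vₓⱼ P(x+eⱼ;i,k)⁻¹ Vₓⱼ⁻¹]·P(x;i,j)⁻¹ = 1`
  (`P(y;κ,μ) = V(∂p_{κμ}(y))`; the one syzygy among the six face relators of the cube — `π₁(S²) = 1`; found by exhaustion over the
  `6!·2⁶` orderings/orientations with single-edge tails, verified in the free group);
* §3 **`norm_d2_plaqF_le`** — for `U1`-valued `V` with `‖V(∂p) − 1‖ ≤ a ≤ 1` on the six faces and `‖V(x,x+e_μ) − 1‖ ≤ β` on the three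
  tails: `‖(F(x+eᵢ;j,k) − F(x;j,k)) − (F(x+eⱼ;i,k) − F(x;i,k)) + (F(x+eₖ;i,j) − F(x;i,j))‖ ≤ 60a² + 6βa` (`F = plaqF V`), i.e. the
  component `(i,j,k)` of the flat coboundary `d₂(F − 1)` — the input «`dΦ = O(ε₁²η³)`» of the cell's curvature-gradient theorem.

References: T. Bałaban, CMP 99 (1985) 75–102 [Balaban1985RegularSpaces] (1.1)–(1.2) (the covariant objects); the lattice Bianchi identity
is folklore (e.g. the non-abelian Stokes theorem for a cube).  No sorry, standard axioms.  NOT a claim about the mass gap.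
-/

set_option autoImplicit false

noncomputable section

open Literature.MathematicalPhysics.QuantumFieldTheory.Balaban1983to89
open B7Prop1Explicit (Site Letter e hol plaqWord stepHol gaugeAct U1 mem_U1 hol_mem hol_lplaqWord lplaqWord_true stepHol_true
  norm_inv_sub_one_le norm_units_conj_sub_one_le)
open B8Ineq132 (plaqF)
open Summit.QuantumFields.BalabanUV.T4Continuum.BlockAverageLoopLogCore (norm_units_conj_sub_self_le)

namespace Summit.QuantumFields.YangMills.Theorems.CurvGradAxial

variable {d : ℕ}

/-! ## §1 Products of near-identity elements in a normed ring -/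

section Ring

variable {𝔸 : Type*} [NormedRing 𝔸] [NormOneClass 𝔸]

/-- `‖Π uₙ − 1‖ ≤ (1 + a)^n − 1` and `‖Π uₙ − 1 − Σ(uₙ − 1)‖ ≤ (1 + a)^n − 1 − n·a` for a list with `‖uₙ − 1‖ ≤ a`. [folklore] -/
theorem norm_prod_sub_one_sub_sum_le {a : ℝ} (ha : 0 ≤ a) : ∀ (l : List 𝔸), (∀ u ∈ l, ‖u - 1‖ ≤ a) →
    ‖l.prod - 1‖ ≤ (1 + a) ^ l.length - 1 ∧ ‖l.prod - 1 - (l.map fun u => u - 1).sum‖ ≤ (1 + a) ^ l.length - 1 - l.length * a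
  | [], _ => by simp
  | u :: l, h => by
    have hu : ‖u - 1‖ ≤ a := h u (by simp)
    obtain ⟨ih1, ih2⟩ := norm_prod_sub_one_sub_sum_le ha l fun v hv => h v (List.mem_cons_of_mem u hv)
    rw [List.prod_cons, List.map_cons, List.sum_cons, List.length_cons]
    set p := l.prod with hp
    set S := (l.map fun u => u - 1).sum with hS
    have hpow : 0 ≤ (1 + a) ^ l.length - 1 := by
      have : (1 : ℝ) ≤ (1 + a) ^ l.length := one_le_pow₀ (by linarith); linarith
    have hpn : ‖p‖ ≤ (1 + a) ^ l.length := by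
      have h1 : ‖p‖ ≤ ‖p - 1‖ + ‖(1 : 𝔸)‖ := by
        have := norm_add_le (p - 1) (1 : 𝔸); rwa [sub_add_cancel] at this
      rw [norm_one] at h1; linarith
    constructor
    · have e1 : u * p - 1 = (u - 1) * p + (p - 1) := by noncomm_ring
      rw [e1, pow_succ]
      calc ‖(u - 1) * p + (p - 1)‖ ≤ ‖u - 1‖ * ‖p‖ + ‖p - 1‖ := (norm_add_le _ _).trans (add_le_add (norm_mul_le _ _) le_rfl)
        _ ≤ a * (1 + a) ^ l.length + ((1 + a) ^ l.length - 1) :=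
            add_le_add (mul_le_mul hu hpn (norm_nonneg _) ha) ih1
        _ = (1 + a) ^ l.length * (1 + a) - 1 := by ring
    · have e1 : u * p - 1 - (u - 1 + S) = (u - 1) * (p - 1) + (p - 1 - S) := by noncomm_ring
      rw [e1, pow_succ, Nat.cast_succ]
      calc ‖(u - 1) * (p - 1) + (p - 1 - S)‖ ≤ ‖u - 1‖ * ‖p - 1‖ + ‖p - 1 - S‖ :=
            (norm_add_le _ _).trans (add_le_add (norm_mul_le _ _) le_rfl)
        _ ≤ a * ((1 + a) ^ l.length - 1) + ((1 + a) ^ l.length - 1 - l.length * a) :=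
            add_le_add (mul_le_mul hu ih1 (norm_nonneg _) ha) ih2
        _ = (1 + a) ^ l.length * (1 + a) - 1 - (l.length + 1) * a := by ring

/-- `‖uPu⁻¹ − 1 − (P − 1)‖ ≤ 2‖u − 1‖·‖P − 1‖` (`u 1 u⁻¹ = 1`). [folklore] -/
theorem norm_conj_sub_one_sub_le {u : 𝔸ˣ} (hu : u ∈ U1 𝔸) (P : 𝔸) :
    ‖(u : 𝔸) * P * ((u⁻¹ : 𝔸ˣ) : 𝔸) - 1 - (P - 1)‖ ≤ 2 * ‖(u : 𝔸) - 1‖ * ‖P - 1‖ := by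
  have e1 : (u : 𝔸) * P * ((u⁻¹ : 𝔸ˣ) : 𝔸) - 1 - (P - 1) = (u : 𝔸) * (P - 1) * ((u⁻¹ : 𝔸ˣ) : 𝔸) - (P - 1) := by
    have h : (u : 𝔸) * (P - 1) * ((u⁻¹ : 𝔸ˣ) : 𝔸) = (u : 𝔸) * P * ((u⁻¹ : 𝔸ˣ) : 𝔸) - 1 := by
      rw [mul_sub, sub_mul, mul_one, Units.mul_inv]
    rw [h]
  rw [e1]; exact norm_units_conj_sub_self_le hu _

/-- `‖P⁻¹ − 1 + (P − 1)‖ ≤ ‖P − 1‖²` for a unit `P ∈ U1` (`P⁻¹ − 1 + P − 1 = −(P − 1)(P⁻¹ − 1)`). [folklore] -/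
theorem norm_inv_sub_one_add_le {P : 𝔸ˣ} (hP : P ∈ U1 𝔸) :
    ‖((P⁻¹ : 𝔸ˣ) : 𝔸) - 1 + ((P : 𝔸) - 1)‖ ≤ ‖(P : 𝔸) - 1‖ * ‖(P : 𝔸) - 1‖ := by
  have e1 : ((P⁻¹ : 𝔸ˣ) : 𝔸) - 1 + ((P : 𝔸) - 1) = -(((P : 𝔸) - 1) * (((P⁻¹ : 𝔸ˣ) : 𝔸) - 1)) := by
    rw [sub_mul, one_mul, mul_sub, mul_one, Units.mul_inv]; abel
  rw [e1, norm_neg]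
  exact (norm_mul_le _ _).trans (mul_le_mul_of_nonneg_left (norm_inv_sub_one_le hP) (norm_nonneg _))

end Ring

/-! ## §2 The lattice Bianchi identity -/

section GroupIdentity

variable {G : Type*} [Group G]

/-- **THE CUBE SYZYGY** in any group, on twelve letters (edges of the unit cube; `P(v; κ, μ) = V(v,κ)V(v+e_κ,μ)V(v+e_μ,κ)⁻¹V(v,μ)⁻¹`):
the product of the six lassoed face holonomies with single-edge tails is trivial. [folklore] -/
theorem cube_lasso (a b c aij aik aji ajk aki akj aijk aikj ajki : G) :
    (a * (aij * aijk * aikj⁻¹ * aik⁻¹) * a⁻¹) * (a * aik * aki⁻¹ * c⁻¹) * (c * (aki * aikj * ajki⁻¹ * akj⁻¹) * c⁻¹) *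
      (b * ajk * akj⁻¹ * c⁻¹)⁻¹ * (b * (aji * aijk * ajki⁻¹ * ajk⁻¹)⁻¹ * b⁻¹) * (a * aij * aji⁻¹ * b⁻¹)⁻¹ = 1 := by
  group

/-- The plaquette holonomy spelled out: `V(∂p_{κμ}(x)) = V(x,κ)V(x+e_κ,μ)V(x+e_μ,κ)⁻¹V(x,μ)⁻¹`. [cite: Balaban1985Averaging, (9) p.18] -/
theorem hol_plaqWord_eq (V : Site d → Fin d → G) (x : Site d) (κ μ : Fin d) :
    hol V x (plaqWord κ μ) = V x κ * V (x + e κ) μ * (V (x + e μ) κ)⁻¹ * (V x μ)⁻¹ := by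
  rw [← lplaqWord_true, hol_lplaqWord, stepHol_true, stepHol_true, B7Prop1Explicit.Letter.vec_true]

/-- **THE LATTICE BIANCHI IDENTITY** for a group-valued configuration on `ℤ^d` and three directions `i, j, k`:
`[V(x,i)·V(∂p_{jk}(x+eᵢ))·V(x,i)⁻¹]·V(∂p_{ik}(x))·[V(x,k)·V(∂p_{ij}(x+eₖ))·V(x,k)⁻¹]·V(∂p_{jk}(x))⁻¹·[V(x,j)·V(∂p_{ik}(x+eⱼ))⁻¹·V(x,j)⁻¹]·V(∂p_{ij}(x))⁻¹ = 1`.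
[folklore] -/
theorem bianchi_prod_eq_one (V : Site d → Fin d → G) (x : Site d) (i j k : Fin d) :
    (V x i * hol V (x + e i) (plaqWord j k) * (V x i)⁻¹) * hol V x (plaqWord i k) *
      (V x k * hol V (x + e k) (plaqWord i j) * (V x k)⁻¹) * (hol V x (plaqWord j k))⁻¹ *
      (V x j * (hol V (x + e j) (plaqWord i k))⁻¹ * (V x j)⁻¹) * (hol V x (plaqWord i j))⁻¹ = 1 := by
  simp only [hol_plaqWord_eq]
  rw [add_right_comm x (e k) (e i), add_right_comm x (e k) (e j), add_right_comm x (e j) (e i)]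
  exact cube_lasso _ _ _ _ _ _ _ _ _ _ _ _

end GroupIdentity

/-! ## §3 The normed form: the flat coboundary of the plaquette field is `O(a² + βa)` -/

section Normed

variable {𝔸 : Type*} [NormedRing 𝔸] [NormOneClass 𝔸]

/-- `(1 + a)⁶ − 1 − 6a ≤ 57a²` for `0 ≤ a ≤ 1` (also the tree's `QuaternionBianchiDefect.pow_six_expansion_le`). [folklore] -/
private theorem pow_six_sub_le {a : ℝ} (ha : 0 ≤ a) (ha1 : a ≤ 1) : (1 + a) ^ 6 - 1 - 6 * a ≤ 57 * a ^ 2 := by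
  nlinarith [mul_nonneg ha ha, mul_nonneg (mul_nonneg ha ha) ha, pow_le_one₀ ha ha1 (n := 2), pow_le_one₀ ha ha1 (n := 3),
    pow_le_one₀ ha ha1 (n := 4), mul_nonneg (mul_nonneg ha ha) (mul_nonneg ha ha)]

/-- **THE FLAT COBOUNDARY OF THE PLAQUETTE FIELD IS `O(a² + βa)`**: for a `U1`-valued configuration `V` on `ℤ^d` whose plaquettes obey
`‖V(∂p) − 1‖ ≤ a ≤ 1` and whose three tail bonds at `x` obey `‖V(x, x+e_μ) − 1‖ ≤ β`, the `(i,j,k)` component of `d₂(F − 1)`,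
`(F(x+eᵢ;j,k) − F(x;j,k)) − (F(x+eⱼ;i,k) − F(x;i,k)) + (F(x+eₖ;i,j) − F(x;i,j))` (`F = plaqF V`), has norm `≤ 60a² + 6βa`.
[folklore] -/
theorem norm_d2_plaqF_le (V : Site d → Fin d → 𝔸ˣ) (hV : ∀ x κ, V x κ ∈ U1 𝔸) {a β : ℝ} (ha : 0 ≤ a) (ha1 : a ≤ 1) (hβ : 0 ≤ β)
    (hP : ∀ (y : Site d) (κ μ : Fin d), κ ≠ μ → ‖plaqF V κ μ y - 1‖ ≤ a) (x : Site d) (hx : ∀ μ, ‖(V x μ : 𝔸) - 1‖ ≤ β)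
    {i j k : Fin d} (hij : i ≠ j) (hik : i ≠ k) (hjk : j ≠ k) :
    ‖(plaqF V j k (x + e i) - plaqF V j k x) - (plaqF V i k (x + e j) - plaqF V i k x) + (plaqF V i j (x + e k) - plaqF V i j x)‖ ≤
      60 * a ^ 2 + 6 * β * a := by
  -- the six lassos as units
  set P₁ : 𝔸ˣ := hol V (x + e i) (plaqWord j k)
  set P₂ : 𝔸ˣ := hol V x (plaqWord i k)
  set P₃ : 𝔸ˣ := hol V (x + e k) (plaqWord i j)
  set P₄ : 𝔸ˣ := hol V x (plaqWord j k)
  set P₅ : 𝔸ˣ := hol V (x + e j) (plaqWord i k)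
  set P₆ : 𝔸ˣ := hol V x (plaqWord i j)
  set L₁ : 𝔸ˣ := V x i * P₁ * (V x i)⁻¹
  set L₃ : 𝔸ˣ := V x k * P₃ * (V x k)⁻¹
  set L₅ : 𝔸ˣ := V x j * P₅⁻¹ * (V x j)⁻¹
  have hprod : L₁ * P₂ * L₃ * P₄⁻¹ * L₅ * P₆⁻¹ = 1 := bianchi_prod_eq_one V x i j k
  -- plaqF as the unit coercion
  have hF : ∀ (y : Site d) (κ μ : Fin d), plaqF V κ μ y = ((hol V y (plaqWord κ μ) : 𝔸ˣ) : 𝔸) := fun _ _ _ => rfl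
  have hP₁ : ‖(P₁ : 𝔸) - 1‖ ≤ a := hP _ j k hjk
  have hP₂ : ‖(P₂ : 𝔸) - 1‖ ≤ a := hP _ i k hik
  have hP₃ : ‖(P₃ : 𝔸) - 1‖ ≤ a := hP _ i j hij
  have hP₄ : ‖(P₄ : 𝔸) - 1‖ ≤ a := hP _ j k hjk
  have hP₅ : ‖(P₅ : 𝔸) - 1‖ ≤ a := hP _ i k hik
  have hP₆ : ‖(P₆ : 𝔸) - 1‖ ≤ a := hP _ i j hij
  have hP₄m : P₄ ∈ U1 𝔸 := hol_mem hV _ _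
  have hP₅m : P₅ ∈ U1 𝔸 := hol_mem hV _ _
  have hP₆m : P₆ ∈ U1 𝔸 := hol_mem hV _ _
  -- each lasso deviates from `1` by at most `a`
  have hL₁ : ‖(L₁ : 𝔸) - 1‖ ≤ a := by
    simp only [L₁, Units.val_mul]; exact (norm_units_conj_sub_one_le (hV x i) _).trans hP₁
  have hL₃ : ‖(L₃ : 𝔸) - 1‖ ≤ a := by
    simp only [L₃, Units.val_mul]; exact (norm_units_conj_sub_one_le (hV x k) _).trans hP₃
  have hL₄ : ‖((P₄⁻¹ : 𝔸ˣ) : 𝔸) - 1‖ ≤ a := (norm_inv_sub_one_le hP₄m).trans hP₄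
  have hL₅ : ‖(L₅ : 𝔸) - 1‖ ≤ a := by
    simp only [L₅, Units.val_mul]
    exact (norm_units_conj_sub_one_le (hV x j) _).trans ((norm_inv_sub_one_le hP₅m).trans hP₅)
  have hL₆ : ‖((P₆⁻¹ : 𝔸ˣ) : 𝔸) - 1‖ ≤ a := (norm_inv_sub_one_le hP₆m).trans hP₆
  -- the product-minus-sum estimate on the six lassos
  have hlist := (norm_prod_sub_one_sub_sum_le ha
    [(L₁ : 𝔸), (P₂ : 𝔸), (L₃ : 𝔸), ((P₄⁻¹ : 𝔸ˣ) : 𝔸), (L₅ : 𝔸), ((P₆⁻¹ : 𝔸ˣ) : 𝔸)] (by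
      intro u hu
      simp only [List.mem_cons, List.mem_nil_iff, or_false] at hu
      rcases hu with h | h | h | h | h | h <;> rw [h]
      exacts [hL₁, hP₂, hL₃, hL₄, hL₅, hL₆])).2
  have hprod' : ([(L₁ : 𝔸), (P₂ : 𝔸), (L₃ : 𝔸), ((P₄⁻¹ : 𝔸ˣ) : 𝔸), (L₅ : 𝔸), ((P₆⁻¹ : 𝔸ˣ) : 𝔸)] : List 𝔸).prod = 1 := by
    have := congrArg (fun u : 𝔸ˣ => (u : 𝔸)) hprod
    simpa only [Units.val_mul, Units.val_one, List.prod_cons, List.prod_nil, mul_one, mul_assoc] using this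
  rw [hprod', sub_self, zero_sub, norm_neg] at hlist
  simp only [List.map_cons, List.map_nil, List.sum_cons, List.sum_nil, add_zero, List.length_cons, List.length_nil] at hlist
  have h57 : ‖((L₁ : 𝔸) - 1) + (((P₂ : 𝔸) - 1) + (((L₃ : 𝔸) - 1) + ((((P₄⁻¹ : 𝔸ˣ) : 𝔸) - 1) + (((L₅ : 𝔸) - 1) +
      (((P₆⁻¹ : 𝔸ˣ) : 𝔸) - 1)))))‖ ≤ 57 * a ^ 2 := hlist.trans (by norm_num; linarith [pow_six_sub_le ha ha1])
  -- the corrections lasso ↦ ±(P − 1)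
  have hc₁ : ‖(L₁ : 𝔸) - 1 - ((P₁ : 𝔸) - 1)‖ ≤ 2 * β * a := by
    simp only [L₁, Units.val_mul]
    exact (norm_conj_sub_one_sub_le (hV x i) _).trans (by nlinarith [hx i, norm_nonneg ((V x i : 𝔸) - 1), norm_nonneg ((P₁ : 𝔸) - 1)])
  have hc₃ : ‖(L₃ : 𝔸) - 1 - ((P₃ : 𝔸) - 1)‖ ≤ 2 * β * a := by
    simp only [L₃, Units.val_mul]
    exact (norm_conj_sub_one_sub_le (hV x k) _).trans (by nlinarith [hx k, norm_nonneg ((V x k : 𝔸) - 1), norm_nonneg ((P₃ : 𝔸) - 1)])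
  have hc₄ : ‖((P₄⁻¹ : 𝔸ˣ) : 𝔸) - 1 + ((P₄ : 𝔸) - 1)‖ ≤ a ^ 2 :=
    (norm_inv_sub_one_add_le hP₄m).trans (by nlinarith [norm_nonneg ((P₄ : 𝔸) - 1)])
  have hc₅ : ‖(L₅ : 𝔸) - 1 + ((P₅ : 𝔸) - 1)‖ ≤ 2 * β * a + a ^ 2 := by
    have h1 : ‖(L₅ : 𝔸) - 1 - (((P₅⁻¹ : 𝔸ˣ) : 𝔸) - 1)‖ ≤ 2 * β * a := by
      simp only [L₅, Units.val_mul]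
      exact (norm_conj_sub_one_sub_le (hV x j) _).trans (by
        nlinarith [hx j, norm_nonneg ((V x j : 𝔸) - 1), norm_nonneg (((P₅⁻¹ : 𝔸ˣ) : 𝔸) - 1),
          (norm_inv_sub_one_le hP₅m).trans hP₅])
    have h2 : ‖((P₅⁻¹ : 𝔸ˣ) : 𝔸) - 1 + ((P₅ : 𝔸) - 1)‖ ≤ a ^ 2 :=
      (norm_inv_sub_one_add_le hP₅m).trans (by nlinarith [norm_nonneg ((P₅ : 𝔸) - 1)])
    have e1 : (L₅ : 𝔸) - 1 + ((P₅ : 𝔸) - 1) = ((L₅ : 𝔸) - 1 - (((P₅⁻¹ : 𝔸ˣ) : 𝔸) - 1)) + (((P₅⁻¹ : 𝔸ˣ) : 𝔸) - 1 + ((P₅ : 𝔸) - 1)) := by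
      abel
    rw [e1]; exact (norm_add_le _ _).trans (add_le_add h1 h2)
  have hc₆ : ‖((P₆⁻¹ : 𝔸ˣ) : 𝔸) - 1 + ((P₆ : 𝔸) - 1)‖ ≤ a ^ 2 :=
    (norm_inv_sub_one_add_le hP₆m).trans (by nlinarith [norm_nonneg ((P₆ : 𝔸) - 1)])
  -- assemble
  rw [hF, hF, hF, hF, hF, hF]
  have e1 : ((P₁ : 𝔸) - (P₄ : 𝔸)) - ((P₅ : 𝔸) - (P₂ : 𝔸)) + ((P₃ : 𝔸) - (P₆ : 𝔸)) =
      (((L₁ : 𝔸) - 1) + (((P₂ : 𝔸) - 1) + (((L₃ : 𝔸) - 1) + ((((P₄⁻¹ : 𝔸ˣ) : 𝔸) - 1) + (((L₅ : 𝔸) - 1) +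
        (((P₆⁻¹ : 𝔸ˣ) : 𝔸) - 1))))))
      - ((L₁ : 𝔸) - 1 - ((P₁ : 𝔸) - 1)) - ((L₃ : 𝔸) - 1 - ((P₃ : 𝔸) - 1))
      + (((P₄⁻¹ : 𝔸ˣ) : 𝔸) - 1 + ((P₄ : 𝔸) - 1)) * (-1) + ((L₅ : 𝔸) - 1 + ((P₅ : 𝔸) - 1)) * (-1)
      + (((P₆⁻¹ : 𝔸ˣ) : 𝔸) - 1 + ((P₆ : 𝔸) - 1)) * (-1) := by noncomm_ring
  rw [e1]
  have hn : ∀ Y : 𝔸, ‖Y * (-1)‖ = ‖Y‖ := fun Y => by rw [mul_neg_one, norm_neg]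
  calc _ ≤ ‖((L₁ : 𝔸) - 1) + (((P₂ : 𝔸) - 1) + (((L₃ : 𝔸) - 1) + ((((P₄⁻¹ : 𝔸ˣ) : 𝔸) - 1) + (((L₅ : 𝔸) - 1) +
        (((P₆⁻¹ : 𝔸ˣ) : 𝔸) - 1)))))‖ + ‖(L₁ : 𝔸) - 1 - ((P₁ : 𝔸) - 1)‖ + ‖(L₃ : 𝔸) - 1 - ((P₃ : 𝔸) - 1)‖
        + ‖(((P₄⁻¹ : 𝔸ˣ) : 𝔸) - 1 + ((P₄ : 𝔸) - 1)) * (-1)‖ + ‖((L₅ : 𝔸) - 1 + ((P₅ : 𝔸) - 1)) * (-1)‖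
        + ‖(((P₆⁻¹ : 𝔸ˣ) : 𝔸) - 1 + ((P₆ : 𝔸) - 1)) * (-1)‖ := by
          refine (norm_add_le _ _).trans (add_le_add ((norm_add_le _ _).trans (add_le_add ((norm_add_le _ _).trans
            (add_le_add ((norm_sub_le _ _).trans (add_le_add (norm_sub_le _ _) le_rfl)) le_rfl)) le_rfl)) le_rfl)
    _ ≤ 57 * a ^ 2 + 2 * β * a + 2 * β * a + a ^ 2 + (2 * β * a + a ^ 2) + a ^ 2 := by
          rw [hn, hn, hn]; gcongr
    _ = 60 * a ^ 2 + 6 * β * a := by ring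

end Normed

end Summit.QuantumFields.YangMills.Theorems.CurvGradAxial

end
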